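import Summits.ResolutionOfSingularities.ResolutionOfSingularities.Theorems.EquisingularLiftEquisingularLiftNatSpecimenConeForms
import HarnessLib

/-!
# [OURS · L1 W4.5(b)] ALL-n CONE FORMS LAYER: `F = G(x₁, …, x_{m+2}) ∈ k[x₀, …, x_{m+2}]`, its dehomogenisations and their radicality
# (crux `Theses.EquisingularLift.EquisingularLiftNat`, stmt-ResolutionOfSingularities-20038 — item 1 of the all-n cone plan)

NOT a statement of any manuscript; OURS generic lemmas (cell `res-hironaka`, chain w45b; seat res-D-pv-013, own initiative, counted 0). AI-written,
weaker than expert review. No definition, no `sorry`, standard axioms.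

The any-dimension port of `…SpecimenConeForms` (p523938, `m = 1`): for `G ∈ k[T₀,…,T_{m+1}]` and the cone form `F = rename Fin.succ G`
(the variable `x₀` is the cone direction):

* `ConeN.isHomogeneous_rename_succ`, `finSuccEquiv_rename_succ`, `prime_rename_succ` — `F` is homogeneous of the degree of `G`, `F = C(G)` in
  `x₀`-adic form, prime when `G` is (positive degree: `Cone.pos_of_prime`, any `σ`);
* `ConeN.dehomogenize_zero_rename_succ` — the vertex chart: `F(x₀ := 1) = G`;
* `ConeN.exists_equiv_succAbove`, **`exists_dehomogenize_succ_eq_rename`** — for the chart `x_{c'+1} = 1`: `F(x_{c'+1} := 1)` is the renaming along a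
  permutation `σ` of `G(T)|_{T_{c'} := 1}` (the idle variable `T_{c'}` becomes the cone coordinate `x₀/x_{c'+1}`) — this is why the chart-regularity
  input of the cone theorems has the idle-variable shape of `Cone.isRegularRing_quotient_aeval_update_one_of_isNonsingularForm` (p526332, any n);
* `ConeN.isRegularRing_quotient_dehomogenize_succ`, `radical_span_dehomogenize_succ`, `radical_span_dehomogenize_zero`;
* `ConeN.rename_succ_mem_span_X_succ` (`F ∈ (x₁,…,x_{m+2})`: the vertex lies on the cone), `exists_X_succ_not_mem_span` (the cone is not
  contained in a coordinate hyperplane through the vertex).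
-/

set_option linter.dupNamespace false -- mandated namespace `Summit.<Summit>.<Problem>` of this single-conjunct summit

noncomputable section

open MvPolynomial
open Literature.AlgebraicGeometry.Resolution
open Literature.AlgebraicGeometry.Motives Literature.AlgebraicGeometry.Motives.SmoothHypersurface
open Literature.AlgebraicGeometry.Motives.ProjectiveSpace

namespace Summit.ResolutionOfSingularities.ResolutionOfSingularities.Cruxes.EquisingularLiftNat.Sections

namespace ConeN

variable (k : Type) [Field k] {m : ℕ} (G : MvPolynomial (Fin (m + 2)) k) {d : ℕ}

/-! ## The cone form `F = G(x₁, …, x_{m+2})` -/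

/-- `F = G(x₁, …, x_{m+2})` is homogeneous of the same degree as `G`. [folklore] -/
theorem isHomogeneous_rename_succ (hG : G.IsHomogeneous d) :
    (rename Fin.succ G : MvPolynomial (Fin (m + 2 + 1)) k).IsHomogeneous d :=
  hG.rename_isHomogeneous

/-- In `x₀`-adic form `F = C(G)`: the cone form is constant in `x₀` over `k[x₁, …, x_{m+2}]`. [folklore] -/
theorem finSuccEquiv_rename_succ : finSuccEquiv k (m + 2) (rename Fin.succ G) = Polynomial.C G := by
  have h := MvPolynomial.algHom_ext (A := Polynomial (MvPolynomial (Fin (m + 2)) k))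
    (f := (finSuccEquiv k (m + 2)).toAlgHom.comp (rename Fin.succ))
    (g := (Polynomial.CAlgHom : MvPolynomial (Fin (m + 2)) k →ₐ[MvPolynomial (Fin (m + 2)) k]
        Polynomial (MvPolynomial (Fin (m + 2)) k)).restrictScalars k
      |>.comp (Algebra.ofId _ _ |>.restrictScalars k)) fun j => by
      simp [finSuccEquiv_X_succ]
  have h' := DFunLike.congr_fun h G
  simpa using h'

/-- **`G` prime ⇒ `F = G(x₁, …, x_{m+2})` prime** (`F = C(G)` in `(k[x₁,…])[x₀]`, Mathlib `Polynomial.prime_C_iff`). [folklore] -/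
theorem prime_rename_succ (hGp : Prime G) : Prime (rename Fin.succ G : MvPolynomial (Fin (m + 2 + 1)) k) := by
  rw [← MulEquiv.prime_iff (finSuccEquiv k (m + 2)), finSuccEquiv_rename_succ]
  exact Polynomial.prime_C_iff.mpr hGp

/-! ## The dehomogenised equations -/

/-- **`F(x₀ := 1) = G`**: on the vertex chart `D₊(x₀)` (coordinates `y_j = x_{j+1}/x₀`) the cone is `V(G)`. [folklore] -/
theorem dehomogenize_zero_rename_succ : dehomogenize k (0 : Fin (m + 2 + 1)) (rename Fin.succ G) = G := by
  have h := MvPolynomial.algHom_ext (A := MvPolynomial (Fin (m + 2)) k)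
    (f := (dehomogenize k (0 : Fin (m + 2 + 1))).comp (rename Fin.succ)) (g := AlgHom.id k _) fun j => by
      rw [AlgHom.comp_apply, rename_X, ← Fin.succAbove_zero, dehomogenize_X_succAbove, AlgHom.id_apply]
  simpa using DFunLike.congr_fun h G

/-- The coordinate permutation of the chart `x_{c'+1} = 1`: a permutation `σ` of `Fin (m+2)` with `(c'+1).succAbove (σ l) = l + 1` for `l ≠ c'`
and `(c'+1).succAbove (σ c') = 0` (the idle slot `c'` goes to the cone coordinate `x₀/x_{c'+1}`). [folklore] -/
theorem exists_equiv_succAbove (c' : Fin (m + 2)) :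
    ∃ σ : Fin (m + 2) ≃ Fin (m + 2), ∀ l, (Fin.succ c').succAbove (σ l) = if l = c' then 0 else Fin.succ l := by
  classical
  let f : Fin (m + 2) → {x : Fin (m + 2 + 1) // x ≠ Fin.succ c'} := fun l =>
    ⟨if l = c' then 0 else Fin.succ l, by
      split_ifs with h
      · exact (Fin.succ_ne_zero c').symm
      · exact fun he => h (Fin.succ_injective _ he)⟩
  have hf : Function.Bijective f := by
    constructor
    · intro a b hab
      have h := congrArg Subtype.val hab
      simp only [f] at h
      by_cases ha : a = c' <;> by_cases hb : b = c'
      · rw [ha, hb]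
      · rw [if_pos ha, if_neg hb] at h
        exact absurd h.symm (Fin.succ_ne_zero b)
      · rw [if_neg ha, if_pos hb] at h
        exact absurd h (Fin.succ_ne_zero a)
      · rw [if_neg ha, if_neg hb] at h
        exact Fin.succ_injective _ h
    · rintro ⟨x, hx⟩
      by_cases hx0 : x = 0
      · exact ⟨c', Subtype.ext (by simp [f, hx0])⟩
      · obtain ⟨l, rfl⟩ := Fin.exists_succ_eq.mpr hx0
        have hl : l ≠ c' := fun h => hx (by rw [h])
        exact ⟨l, Subtype.ext (by simp [f, hl])⟩
  refine ⟨(Equiv.ofBijective f hf).trans (finSuccAboveEquiv (Fin.succ c')).symm, fun l => ?_⟩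
  have h := congrArg Subtype.val ((finSuccAboveEquiv (Fin.succ c')).apply_symm_apply (f l))
  rw [finSuccAboveEquiv_apply] at h
  exact h

/-- **`F(x_{c'+1} := 1)` is a coordinate renaming of `G(T)|_{T_{c'} := 1}`** (the chart `x_{c'+1} = 1` of the cone over `V₊(G)` is the chart
`T_{c'} = 1` of `V₊(G)` times the line of the idle variable). [folklore] -/
theorem exists_dehomogenize_succ_eq_rename (c' : Fin (m + 2)) :
    ∃ σ : Fin (m + 2) ≃ Fin (m + 2), dehomogenize k (Fin.succ c') (rename Fin.succ G) =
      rename σ (aeval (Function.update (X : Fin (m + 2) → MvPolynomial (Fin (m + 2)) k) c' 1) G) := by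
  obtain ⟨σ, hσ⟩ := exists_equiv_succAbove (m := m) c'
  refine ⟨σ, ?_⟩
  have h := MvPolynomial.algHom_ext (A := MvPolynomial (Fin (m + 2)) k)
    (f := (dehomogenize k (Fin.succ c')).comp (rename Fin.succ))
    (g := (rename σ).comp (aeval (Function.update (X : Fin (m + 2) → MvPolynomial (Fin (m + 2)) k) c' 1))) fun l => by
      rw [AlgHom.comp_apply, rename_X, AlgHom.comp_apply, aeval_X]
      by_cases hl : l = c'
      · subst hl
        rw [Function.update_self, map_one, dehomogenize_X_self]
      · rw [Function.update_of_ne hl, rename_X]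
        have hs := hσ l
        rw [if_neg hl] at hs
        rw [← hs, dehomogenize_X_succAbove]
  simpa using DFunLike.congr_fun h G

/-! ## Regularity and radicality of the chart equations -/

/-- **The off-vertex chart rings are regular**: `k[y]/(F(x_{c'+1} := 1))` is regular as soon as `k[T]/(G|_{T_{c'} := 1})` is. [folklore] -/
theorem isRegularRing_quotient_dehomogenize_succ (c' : Fin (m + 2))
    (hreg : IsRegularRing (MvPolynomial (Fin (m + 2)) k ⧸
      Ideal.span {aeval (Function.update (X : Fin (m + 2) → MvPolynomial (Fin (m + 2)) k) c' 1) G})) :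
    IsRegularRing (MvPolynomial (Fin (m + 2)) k ⧸ Ideal.span {dehomogenize k (Fin.succ c') (rename Fin.succ G)}) := by
  obtain ⟨σ, hσ⟩ := exists_dehomogenize_succ_eq_rename k G c'
  haveI := hreg
  have hmap : Ideal.map (renameEquiv k σ).toRingEquiv
      (Ideal.span {aeval (Function.update (X : Fin (m + 2) → MvPolynomial (Fin (m + 2)) k) c' 1) G}) =
      Ideal.span {dehomogenize k (Fin.succ c') (rename Fin.succ G)} := by
    rw [Ideal.map_span, Set.image_singleton, hσ]
    rfl
  exact IsRegularRing.of_ringEquiv (Ideal.quotientEquiv _ _ (renameEquiv k σ).toRingEquiv hmap.symm)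

/-- … hence `(F(x_{c'+1} := 1))` is a radical ideal. [folklore] -/
theorem radical_span_dehomogenize_succ (c' : Fin (m + 2))
    (hreg : IsRegularRing (MvPolynomial (Fin (m + 2)) k ⧸
      Ideal.span {aeval (Function.update (X : Fin (m + 2) → MvPolynomial (Fin (m + 2)) k) c' 1) G})) :
    (Ideal.span {dehomogenize k (Fin.succ c') (rename Fin.succ G)}).radical =
      Ideal.span {dehomogenize k (Fin.succ c') (rename Fin.succ G)} := by
  haveI := isRegularRing_quotient_dehomogenize_succ k G c' hreg
  haveI := IsRegularRing.isReduced' (MvPolynomial (Fin (m + 2)) k ⧸ Ideal.span {dehomogenize k (Fin.succ c') (rename Fin.succ G)})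
  exact (Ideal.isRadical_iff_quotient_reduced _).mpr inferInstance |>.radical

/-- `(F(x₀ := 1)) = (G)` is radical when `G` is prime. [folklore] -/
theorem radical_span_dehomogenize_zero (hGp : Prime G) :
    (Ideal.span {dehomogenize k (0 : Fin (m + 2 + 1)) (rename Fin.succ G)}).radical =
      Ideal.span {dehomogenize k (0 : Fin (m + 2 + 1)) (rename Fin.succ G)} := by
  rw [dehomogenize_zero_rename_succ]
  exact ((Ideal.span_singleton_prime hGp.ne_zero).mpr hGp).radical

/-! ## `F ∈ (x₁, …, x_{m+2})` and some `x_{a+1} ∉ (F)` -/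

/-- **`F ∈ (x₁, …, x_{m+2})`** for `G` homogeneous of positive degree (no constant term): the vertex lies on the cone. [folklore] -/
theorem rename_succ_mem_span_X_succ (hG : G.IsHomogeneous d) (hd : 0 < d) :
    (rename Fin.succ G : MvPolynomial (Fin (m + 2 + 1)) k) ∈
      Ideal.span (Set.range fun j : Fin (m + 2) => (X j.succ : MvPolynomial (Fin (m + 2 + 1)) k)) := by
  classical
  have hG0 : G.coeff 0 = 0 := hG.coeff_eq_zero (by
    rw [map_zero]
    omega)
  have hmem : G ∈ Ideal.span (Set.range (X : Fin (m + 2) → MvPolynomial (Fin (m + 2)) k)) := by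
    rw [← Set.image_univ, MvPolynomial.mem_ideal_span_X_image]
    intro n hn
    have hn0 : n ≠ 0 := by
      rintro rfl
      exact (mem_support_iff.mp hn) hG0
    obtain ⟨j, hj⟩ := Finsupp.ne_iff.mp hn0
    exact ⟨j, Set.mem_univ _, hj⟩
  have h := Ideal.mem_map_of_mem
    (rename (Fin.succ : Fin (m + 2) → Fin (m + 2 + 1)) : MvPolynomial (Fin (m + 2)) k →ₐ[k] MvPolynomial (Fin (m + 2 + 1)) k) hmem
  rw [Ideal.map_span, ← Set.range_comp] at h
  have hfun : (⇑(rename (Fin.succ : Fin (m + 2) → Fin (m + 2 + 1)) : MvPolynomial (Fin (m + 2)) k →ₐ[k] MvPolynomial (Fin (m + 2 + 1)) k) ∘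
      (X : Fin (m + 2) → MvPolynomial (Fin (m + 2)) k)) = fun j : Fin (m + 2) => (X j.succ : MvPolynomial (Fin (m + 2 + 1)) k) := by
    funext j
    simp [rename_X]
  rwa [hfun] at h

/-- **Some `x_{a+1}` is not a multiple of `F`** (`G` prime): else `x₁` and `x₂` would both be associated to the prime `F`. [folklore] -/
theorem exists_X_succ_not_mem_span (hGp : Prime G) :
    ∃ a : Fin (m + 2), (X a.succ : MvPolynomial (Fin (m + 2 + 1)) k) ∉
      Ideal.span {(rename Fin.succ G : MvPolynomial (Fin (m + 2 + 1)) k)} := by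
  by_contra h
  push Not at h
  have hF := prime_rename_succ k G hGp
  have h1 : (rename Fin.succ G : MvPolynomial (Fin (m + 2 + 1)) k) ∣ X (Fin.succ 0) := Ideal.mem_span_singleton.mp (h 0)
  have h2 : (rename Fin.succ G : MvPolynomial (Fin (m + 2 + 1)) k) ∣ X (Fin.succ 1) := Ideal.mem_span_singleton.mp (h 1)
  have a1 := hF.irreducible.associated_of_dvd (X_prime (i := (Fin.succ 0 : Fin (m + 2 + 1))) (R := k)).irreducible h1
  have a2 := hF.irreducible.associated_of_dvd (X_prime (i := (Fin.succ 1 : Fin (m + 2 + 1))) (R := k)).irreducible h2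
  have a12 : Associated (X (Fin.succ 0) : MvPolynomial (Fin (m + 2 + 1)) k) (X (Fin.succ 1)) := a1.symm.trans a2
  have hdvd := a12.dvd
  rw [X_dvd_X] at hdvd
  exact absurd (Fin.succ_injective _ hdvd) (by simp)

end ConeN

end Summit.ResolutionOfSingularities.ResolutionOfSingularities.Cruxes.EquisingularLiftNat.Sections

end
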